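import Literature.MathematicalPhysics.QuantumChemistry.ThreeIndexRelaxationBound
import Literature.MathematicalPhysics.QuantumChemistry.QCondition
import Literature.LinearAlgebra.Matrix.NearestPositiveSemidefinite
import HarnessLib

/-!
# The reduced-density-matrix lower bound for an ARBITRARY finite set of necessary
# `N`-representability conditions, and its dual-cone (SDP weak-duality) certificate form
# (Cancès–Stoltz–Lewin 2006, §3)

Topic `Literature/MathematicalPhysics/QuantumChemistry`. The topic already proves the variational
2-RDM lower bound for two FIXED, hand-written condition lists — `IsDQGFeasible(Sector)`
(`le_sectorGroundEnergy_of_forall_isDQGFeasibleSector`, `VariationalRDMRelaxation.lean`) and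
`IsDQGT1T2PrimeFeasible(Sector)` (`ThreeIndexRelaxationBound.lean`) — and, at the operator
(sum-of-squares) level, the soundness of an exact dual certificate with ONE stacked positive
semidefinite multiplier (`StateRelaxation.le_re_map_of_certificate`; venture side
`lowerRow_of_certificate`). This file types the PRINTED GENERIC formulation, in which the set of
conditions is an arbitrary finite list, as in

* E. Cancès, G. Stoltz, M. Lewin, *The electronic ground-state energy problem: a new reduced
  density matrix approach*, J. Chem. Phys. 125 (2006) 064101 = arXiv:quant-ph/0602042, §3 "Dual
  formulation of the RDM minimization problem" (held copy `paper:arxiv-quant-ph_0602042`, page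
  files p0005–p0006 opened 2026-08-26; equation numbers below are those of the arXiv version):

  "it is necessary to approximate (4) by a variational problem that can be carried out
  numerically. To this end, some necessary conditions for `N`-representability are selected. We
  consider in this paper `L` conditions of the following general form
  `∀ ℓ = 1…L, 𝓛_ℓ(Γ) ≥ 0` (7), where for any `ℓ`, `𝓛_ℓ : 𝒮₂ → 𝒮(X_ℓ)` is a linear map and `X_ℓ`
  is some vector space. For instance, the so-called P-condition `𝓛₁(Γ) = Γ ≥ 0` … Imposing only
  the necessary conditions (7) means that `𝒞_N` is replaced by the approximate cone
  `𝒞_app ⊃ 𝒞_N` defined as `𝒞_app := {Γ ∈ 𝒮₂ | ∀ ℓ = 1…L, 𝓛_ℓ(Γ) ≥ 0}`. Its polar cone can easily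
  be shown to be `(𝒞_app)* := {Σ_{ℓ=1}^L (𝓛_ℓ)* B_ℓ | B_ℓ ∈ 𝒮(X_ℓ), B_ℓ ≥ 0}` (8), and the associated
  approximate energy is then `E_app = inf_{Γ ∈ 𝒞_app, tr(Γ) = N(N−1)} tr(K_N Γ)` (9)
  `= N(N−1) sup {μ | K_N − μ ∈ (𝒞_app)*}` (10). Let us emphasize that, since `𝒞_app ⊃ 𝒞_N`, the
  energy `E_app` is a lower bound to the full CI energy in the chosen basis, `E_app ≤ E`."
  … "Some well-known necessary conditions of the form (7) are the P, Q, G conditions. Additional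
  necessary conditions can be considered, such as Erdahl's T₁ and T₂ conditions … our algorithm …
  is valid for any set of necessary conditions of the form (7)."

* M. Nakata et al., J. Chem. Phys. 128 (2008) 164113, §II.C–D (held copy
  `paper:doi-10-1063-1-2911696` pp. 164113-4/5 opened): "`E_PQG ≤ E_PQGT1 ≤ E_PQGT1T2 ≤ E_PQGT1T2′
  ≤ E_fullCI`"; "We formulate the RDM method as a dual standard SDP … P, Q, G, T1, and T2′ (or T2)
  conditions will correspond to the block-diagonal matrices of `Σ_p A_p[y]_p − C`" (eq. (2.1)).

WHAT IS TYPED, in the tree's vocabulary (abstract pairs `(γ, Γ) = (¹D, ²D)` at unit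
normalisation, `Γ^{ij}_{kl} = ⟨a†_i a†_j a_l a_k⟩` of trace `N(N−1)` — `PositivityConditions.lean`;
energy functional `rdmEnergy h g h_nuc γ Γ` with `rdmEnergy_rdm : E(¹D(ψ), ²D(ψ)) = ⟨ψ|Ĥ|ψ⟩` —
`VariationalRDMRelaxation.lean`; exact energies `groundEnergy Ĥ N`, `sectorGroundEnergy Ĥ a b`):

1. `IsNecessary N C` / `IsNecessaryInSector a b C` — a predicate `C` on pairs is NECESSARY (CSL:
   "some necessary conditions for `N`-representability are selected"; `𝒞_app ⊃ 𝒞_N`) iff the RDM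
   pair of every unit `N`-particle (resp. `(N_α, N_β) = (a, b)`-sector) vector satisfies it; closed
   under conjunction (`and` — ADDING conditions keeps a list necessary) and weakening (`mono`);
   implied by the ensemble form (`isNecessary_of_forall_isEnsembleNRepresentable`); the topic's
   named conditions and fixed lists are instances (`isNecessary_qCondition`,
   `isNecessary_isDQGFeasible`, `isNecessaryInSector_isDQGT1T2PrimeFeasibleSector`, …) — the
   aggregator into which every stand-alone condition predicate plugs by its own necessity lemma.
2. **`le_groundEnergy_of_forall_necessary`, `le_sectorGroundEnergy_of_forall_necessary`** —
   CSL's "since `𝒞_app ⊃ 𝒞_N`, `E_app ≤ E`" for an ARBITRARY necessary condition set: any real `c`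
   below `Re E(γ, Γ)` on the `C`-feasible pairs (the value (9), or any certified lower bound of it
   — the hook for a-posteriori SDP bounds valid on the feasible set,
   `Literature.Computation.Certificates.JanssonChaykinKeil.*`) satisfies `c ≤ E₀(Ĥ; N)` resp.
   `c ≤ E₀(Ĥ; a, b)`; the topic's fixed-list theorems are the cases `C = IsDQGFeasibleSector a b`,
   `IsDQGT1T2PrimeFeasibleSector a b`.
3. `PosMapFeasible L` — CSL (7): a finite family `c : κ` of matrix-valued maps
   `(γ, Γ) ↦ 𝓛_c(γ, Γ) ∈ Matrix (X c) (X c) ℂ` (one block type per condition: pairs for P/Q/G,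
   triples for T1/T2, a sum type for T2′), feasible iff every `𝓛_c(γ, Γ) ⪰ 0`;
   `posMapFeasible_dqgMaps_iff`: CSL's P, Q, G list is the topic's `Γ ⪰ 0 ∧ qMap ⪰ 0 ∧ gMap ⪰ 0`.
4. **`le_re_rdmEnergy_of_dualCone_certificate`** (pointwise weak duality),
   **`le_sectorGroundEnergy_of_dualCone_certificate`**, **`le_groundEnergy_of_dualCone_certificate`**
   — CSL (8)+(10) read as a CERTIFICATE: multipliers `B_c ⪰ 0`, free multipliers `λ_r` for
   finitely many necessary EQUALITY rows `A_r(γ, Γ) = b_r` (CSL carry the single row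
   `tr Γ = N(N−1)` with multiplier `μ`; the topic's lists carry traces, contraction, antisymmetry,
   `S_z` rows) and the Lagrangian identity
   `E(γ, Γ) − μ = Σ_c tr(B_c · 𝓛_c(γ, Γ)) + Σ_r λ_r (A_r(γ, Γ) − b_r)` for ALL pairs — for linear
   `𝓛_c` and affine `A_r` an identity of affine functions, i.e. literally the membership
   `K_N − μ ∈ (𝒞_app)* = {Σ_c (𝓛_c)* B_c}` of (8)/(10), the adjoint being DEFINED by
   `tr((𝓛_c)*B · Γ) = tr(B · 𝓛_c(Γ))` — give `μ ≤ Re E(γ, Γ)` at every feasible pair (`tr(B 𝓛) ≥ 0`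
   for `B, 𝓛 ⪰ 0`, `NearestPositiveSemidefinite.re_trace_mul_nonneg`), hence `μ ≤ E₀` by item 2.

Everything is PROVED (0 sorry, no named fact) by one-line instantiation of the topic's theorems
(`exists_unit_eigen_sectorGroundEnergy`, `rdmEnergy_rdm`, `ThermodynamicLimit.groundEnergySet_nonempty`,
the `of_state` necessity lemmas). DESIGN NOTES. (i) Linearity of `𝓛_c` (printed) is not needed for
soundness and is not a hypothesis; it is what makes the identity of item 4 a finite coefficientwise
check. (ii) The value `E_app` of (9) is NOT a definition here: for an arbitrary necessary `C` the
functional need not be bounded below on the feasible set (a real `sInf` would be a junk `0`), so the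
junk-free "every `c` below the functional on the feasible set is `≤ E`" is stated; for the fixed
lists `le_pqgSectorEnergy_iff` identifies the two. (iii) CSL work in the `N`-electron cone ("we did
not impose any constraint on the spin state … such constraints can be easily taken into account",
§2); the `N`-electron and the `(N_α, N_β)`-sector forms are both given.
NOT HERE: strong duality / attainment; the generic a-posteriori (inexact-dual) SDP bound — typed
ONCE under `Literature/Computation/Certificates/SemidefiniteRigorousBounds.lean` (Jansson–Chaykin–
Keil) and composed with item 2, not restated; the operator-level (second-quantised SOS) certificate
(`StateRelaxationDuality.lean`, the venture's `Rows/SectorRows.lean`).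

## References
* E. Cancès, G. Stoltz, M. Lewin, J. Chem. Phys. 125 (2006) 064101, §3 eqs. (7)–(10)
  (arXiv:quant-ph/0602042). [cite: CancesStoltzLewin2006, §3 eqs. (7)-(10)]
* M. Nakata et al., J. Chem. Phys. 128 (2008) 164113, §II.C (the chain `E_PQG ≤ … ≤ E_fullCI`),
  §II.D eq. (2.1) (conditions = blocks of an LMI). [cite: NakataEtAl2008, §II.C-D]
* D. A. Mazziotti, *Variational two-electron reduced-density-matrix theory*, Adv. Chem. Phys. 134
  (2007) ch. 3, §II.B ("necessary `N`-representability conditions"), §II.F (`S_z` blocks).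
  [cite: Mazziotti2007RDMChapter, §II.B, §II.F]
-/

noncomputable section

namespace Literature.MathematicalPhysics.QuantumChemistry

open Matrix Finset Literature.MathematicalPhysics.QuantumLattice
open scoped ComplexOrder

/-! ### Necessary conditions: the approximate cone `𝒞_app ⊇ 𝒞_N` (`N`-electron form) -/

section Necessary

variable {ι : Type*} [LinearOrder ι] [Fintype ι] {Λ : Type*} [LinearOrder Λ] [Fintype Λ]

/-- A predicate `C` on abstract pairs `(γ, Γ) = (¹D, ²D)` is a **necessary condition for `N`
electrons** if the reduced density matrices of every UNIT `N`-particle vector satisfy it — the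
`C`-feasible set contains the (pure-state) `N`-representable pairs: Cancès–Stoltz–Lewin's
"`𝒞_app ⊃ 𝒞_N`" for the set `𝒞_app` cut out by `C` ("some necessary conditions for `N`-representability
are selected", §3 before eq. (7)). [cite: CancesStoltzLewin2006, §3 eq. (7)] -/
def IsNecessary (N : ℕ) (C : Matrix ι ι ℂ → Matrix (ι × ι) (ι × ι) ℂ → Prop) : Prop :=
  ∀ ψ : Fock ι, IsNParticle N ψ → star ψ ⬝ᵥ ψ = 1 → C (oneRDM ψ) (twoRDM ψ)

/-- **Adding conditions keeps the list necessary**: the conjunction of two necessary conditions is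
necessary (CSL's `𝒞_app` for the list `𝓛_1, …, 𝓛_L` is the intersection of the single-condition
cones; "Additional necessary conditions can be considered"). [cite: CancesStoltzLewin2006, §3 eq. (7)] -/
theorem IsNecessary.and {N : ℕ} {C D : Matrix ι ι ℂ → Matrix (ι × ι) (ι × ι) ℂ → Prop}
    (hC : IsNecessary N C) (hD : IsNecessary N D) : IsNecessary N fun γ Γ => C γ Γ ∧ D γ Γ :=
  fun ψ hN h1 => ⟨hC ψ hN h1, hD ψ hN h1⟩

/-- A condition implied by a necessary one is necessary (enlarging `𝒞_app` keeps `𝒞_app ⊃ 𝒞_N`).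
[cite: CancesStoltzLewin2006, §3 eq. (7)] -/
theorem IsNecessary.mono {N : ℕ} {C D : Matrix ι ι ℂ → Matrix (ι × ι) (ι × ι) ℂ → Prop}
    (hC : IsNecessary N C) (hCD : ∀ γ Γ, C γ Γ → D γ Γ) : IsNecessary N D :=
  fun ψ hN h1 => hCD _ _ (hC ψ hN h1)

/-- **The printed (ensemble) form implies the state form**: if every ensemble `N`-representable pair
(`IsEnsembleNRepresentable`, the cone `𝒞_N = L²_N(𝒫_N)` of CSL §2 at unit normalisation) satisfies
`C`, then `C` is necessary (the RDM pair of a unit `N`-particle vector is representable,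
`isPureNRepresentable_rdm`). [cite: CancesStoltzLewin2006, §2-3] -/
theorem isNecessary_of_forall_isEnsembleNRepresentable {N : ℕ}
    {C : Matrix ι ι ℂ → Matrix (ι × ι) (ι × ι) ℂ → Prop}
    (h : ∀ γ Γ, IsEnsembleNRepresentable N γ Γ → C γ Γ) : IsNecessary N C :=
  fun _ hN h1 => h _ _ (isPureNRepresentable_rdm hN h1).isEnsembleNRepresentable

/-- Instance: the stand-alone **Q-condition** `qMap γ Γ ⪰ 0` (`QCondition.lean`) is necessary for
every `N` (`qCondition_rdm`) — the pattern by which each named condition predicate of the topic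
enters an arbitrary condition list. CSL §3: "Some well-known necessary conditions of the form (7)
are the P, Q, G conditions". [cite: CancesStoltzLewin2006, §3 after eq. (10)] -/
theorem isNecessary_qCondition (N : ℕ) : IsNecessary N (QCondition (ι := ι)) :=
  fun _ _ h1 => qCondition_rdm h1

/-- Instance: the topic's **P, Q, G list with its linear rows** (`IsDQGFeasible N`) is necessary
(`IsDQGFeasible.of_state`). Mazziotti (2007) §II.B; CSL §3. [cite: CancesStoltzLewin2006, §3 eq. (7)] -/
theorem isNecessary_isDQGFeasible (N : ℕ) : IsNecessary N (IsDQGFeasible (ι := ι) N) :=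
  fun _ hN h1 => IsDQGFeasible.of_state hN h1

/-- Instance: the topic's **P, Q, G, T1, T2′ list** (`IsDQGT1T2PrimeFeasible N`) is necessary
(`IsDQGT1T2PrimeFeasible.of_state`). Nakata et al. (2008) §II.A–C; CSL §3 ("Additional necessary
conditions … Erdahl's T₁ and T₂"). [cite: CancesStoltzLewin2006, §3 eq. (7)] -/
theorem isNecessary_isDQGT1T2PrimeFeasible (N : ℕ) :
    IsNecessary N (IsDQGT1T2PrimeFeasible (ι := ι) N) :=
  fun _ hN h1 => IsDQGT1T2PrimeFeasible.of_state hN h1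

/-! ### Necessary conditions in an `S_z` sector `(N_α, N_β) = (a, b)` -/

/-- A predicate `C` on pairs over the spin orbitals `Orb Λ` is a **necessary condition in the sector
`(N_α, N_β) = (a, b)`** if the RDM pair of every unit vector supported on that sector satisfies it
(CSL's `𝒞_app ⊃ 𝒞_N`, with the spin constraints "easily taken into account" (§2) as in Mazziotti
2007 §II.F: conditions may involve the sector data `a, b`). [cite: CancesStoltzLewin2006, §3 eq. (7)] -/
def IsNecessaryInSector (a b : ℕ)
    (C : Matrix (Orb Λ) (Orb Λ) ℂ → Matrix (Orb Λ × Orb Λ) (Orb Λ × Orb Λ) ℂ → Prop) : Prop :=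
  ∀ ψ : Fock (Orb Λ), IsInSector a b ψ → star ψ ⬝ᵥ ψ = 1 → C (oneRDM ψ) (twoRDM ψ)

/-- Conjunction of sector-necessary conditions is sector-necessary (adding conditions / rows).
[cite: CancesStoltzLewin2006, §3 eq. (7)] -/
theorem IsNecessaryInSector.and {a b : ℕ}
    {C D : Matrix (Orb Λ) (Orb Λ) ℂ → Matrix (Orb Λ × Orb Λ) (Orb Λ × Orb Λ) ℂ → Prop}
    (hC : IsNecessaryInSector a b C) (hD : IsNecessaryInSector a b D) :
    IsNecessaryInSector a b fun γ Γ => C γ Γ ∧ D γ Γ :=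
  fun ψ hψ h1 => ⟨hC ψ hψ h1, hD ψ hψ h1⟩

/-- Weakening a sector-necessary condition keeps it necessary. [cite: CancesStoltzLewin2006, §3 eq. (7)] -/
theorem IsNecessaryInSector.mono {a b : ℕ}
    {C D : Matrix (Orb Λ) (Orb Λ) ℂ → Matrix (Orb Λ × Orb Λ) (Orb Λ × Orb Λ) ℂ → Prop}
    (hC : IsNecessaryInSector a b C) (hCD : ∀ γ Γ, C γ Γ → D γ Γ) : IsNecessaryInSector a b D :=
  fun ψ hψ h1 => hCD _ _ (hC ψ hψ h1)

/-- A condition necessary for `N = a + b` electrons is necessary in the sector `(a, b)` (sector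
vectors are `(a + b)`-particle vectors, `IsInSector.isNParticle`). [cite: CancesStoltzLewin2006, §3 eq. (7)] -/
theorem IsNecessary.isNecessaryInSector {a b : ℕ}
    {C : Matrix (Orb Λ) (Orb Λ) ℂ → Matrix (Orb Λ × Orb Λ) (Orb Λ × Orb Λ) ℂ → Prop}
    (hC : IsNecessary (a + b) C) : IsNecessaryInSector a b C :=
  fun ψ hψ h1 => hC ψ hψ.isNParticle h1

/-- Instance: the topic's **sector P, Q, G list** (`IsDQGFeasibleSector a b`: DQG + `S_z` selection
rule + spin-resolved traces, Mazziotti 2007 §II.F) is sector-necessary (`IsDQGFeasibleSector.of_state`).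
[cite: Mazziotti2007RDMChapter, §II.F eqs. (87)-(90)] -/
theorem isNecessaryInSector_isDQGFeasibleSector (a b : ℕ) :
    IsNecessaryInSector a b (IsDQGFeasibleSector (Λ := Λ) a b) :=
  fun _ hψ h1 => IsDQGFeasibleSector.of_state hψ h1

/-- Instance: the topic's **sector P, Q, G, T1, T2′ list** (`IsDQGT1T2PrimeFeasibleSector a b`) is
sector-necessary (`IsDQGT1T2PrimeFeasibleSector.of_state`). Nakata et al. (2008) §II.A–C.
[cite: NakataEtAl2008, §II.A-C] -/
theorem isNecessaryInSector_isDQGT1T2PrimeFeasibleSector (a b : ℕ) :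
    IsNecessaryInSector a b (IsDQGT1T2PrimeFeasibleSector (Λ := Λ) a b) :=
  fun _ hψ h1 => IsDQGT1T2PrimeFeasibleSector.of_state hψ h1

/-! ### `E_app ≤ E` for an arbitrary necessary condition set -/

/-- **THE RDM LOWER BOUND FOR AN ARBITRARY NECESSARY CONDITION SET (`N`-electron form).** If `C` is
a necessary condition for `N` electrons (`N ≤ 2|Λ|`, non-empty sector) and a real number `c` lies
below the energy functional `Re E(γ, Γ)` at every `C`-feasible pair — in particular the value
`E_app` of the relaxed minimisation (9), or any certified lower bound of it — then
`c ≤ E₀(Ĥ(h, g, h_nuc); N)`, the exact `N`-electron ground-state energy in the spin-orbital basis.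
Cancès–Stoltz–Lewin (2006) §3: "since `𝒞_app ⊃ 𝒞_N`, the energy `E_app` is a lower bound to the
full CI energy in the chosen basis, `E_app ≤ E`"; Nakata et al. (2008) §II.C
(`E_PQG ≤ E_PQGT1 ≤ … ≤ E_fullCI`). [cite: CancesStoltzLewin2006, §3 eqs. (9)-(10)] -/
theorem le_groundEnergy_of_forall_necessary (h : Λ → Λ → ℂ) (g : Λ → Λ → Λ → Λ → ℂ) (hnuc : ℂ)
    {N : ℕ} (hN : N ≤ Fintype.card (Orb Λ))
    {C : Matrix (Orb Λ) (Orb Λ) ℂ → Matrix (Orb Λ × Orb Λ) (Orb Λ × Orb Λ) ℂ → Prop}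
    (hC : IsNecessary N C) {c : ℝ} (hc : ∀ γ Γ, C γ Γ → c ≤ (rdmEnergy h g hnuc γ Γ).re) :
    c ≤ Literature.MathematicalPhysics.QuantumLattice.groundEnergy (molecularHamiltonian h g hnuc) N := by
  unfold Literature.MathematicalPhysics.QuantumLattice.groundEnergy
  refine le_csInf (ThermodynamicLimit.groundEnergySet_nonempty _ hN) ?_
  rintro E ⟨ψ, hψN, hψ1, rfl⟩
  have hE := hc _ _ (hC ψ hψN hψ1)
  rwa [rdmEnergy_rdm h g hnuc hψ1] at hE

/-- **THE RDM LOWER BOUND FOR AN ARBITRARY NECESSARY CONDITION SET (sector form).** For Hermitian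
integral data and a non-trivial sector `a, b ≤ |Λ|`: if `C` is necessary in the sector `(a, b)` and
`c ≤ Re E(γ, Γ)` at every `C`-feasible pair, then `c ≤ E₀(Ĥ; N_α = a, N_β = b)`
(`sectorGroundEnergy`, the quantity of the certified-quantum-chemistry rows). The topic's
`le_sectorGroundEnergy_of_forall_isDQGFeasibleSector` / `…isDQGT1T2PrimeFeasibleSector` are the
cases `C = IsDQGFeasibleSector a b` / `IsDQGT1T2PrimeFeasibleSector a b`. Cancès–Stoltz–Lewin (2006)
§3 (`E_app ≤ E`); Mazziotti (2007) §II.F (sector rows). [cite: CancesStoltzLewin2006, §3 eqs. (9)-(10)] -/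
theorem le_sectorGroundEnergy_of_forall_necessary {h : Λ → Λ → ℂ} {g : Λ → Λ → Λ → Λ → ℂ}
    {hnuc : ℂ} (hH : (molecularHamiltonian h g hnuc).IsHermitian) {a b : ℕ}
    (ha : a ≤ Fintype.card Λ) (hb : b ≤ Fintype.card Λ)
    {C : Matrix (Orb Λ) (Orb Λ) ℂ → Matrix (Orb Λ × Orb Λ) (Orb Λ × Orb Λ) ℂ → Prop}
    (hC : IsNecessaryInSector a b C) {c : ℝ}
    (hc : ∀ γ Γ, C γ Γ → c ≤ (rdmEnergy h g hnuc γ Γ).re) :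
    c ≤ sectorGroundEnergy (molecularHamiltonian h g hnuc) a b := by
  obtain ⟨ψ, hψ, hψ1, hHψ⟩ := exists_unit_eigen_sectorGroundEnergy hH ha hb
  have hE := hc _ _ (hC ψ hψ hψ1)
  rw [rdmEnergy_rdm h g hnuc hψ1, hHψ, dotProduct_smul, hψ1, smul_eq_mul, mul_one,
    Complex.ofReal_re] at hE
  exact hE

end Necessary

/-! ### Positive-map condition families (CSL eq. (7)) and dual-cone certificates (eqs. (8), (10)) -/

section DualCone

variable {ι : Type*} [LinearOrder ι] [Fintype ι]
variable {κ : Type*} [Fintype κ] {X : κ → Type*} [∀ c, Fintype (X c)]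

/-- **A finite family of positivity conditions given by matrix-valued maps** (Cancès–Stoltz–Lewin
eq. (7): "`∀ ℓ = 1…L, 𝓛_ℓ(Γ) ≥ 0` where `𝓛_ℓ : 𝒮₂ → 𝒮(X_ℓ)` is a linear map and `X_ℓ` is some
vector space"): condition `c : κ` sends a pair `(γ, Γ)` to a square matrix `L c γ Γ` over its own
index type `X c`, and the pair is FEASIBLE iff all these matrices are positive semidefinite — the
approximate cone `𝒞_app := {Γ | ∀ ℓ, 𝓛_ℓ(Γ) ≥ 0}`. (Linearity of the maps, printed, is not recorded:
it is not needed for `E_app ≤ E`; see the module docstring.) [cite: CancesStoltzLewin2006, §3 eq. (7)] -/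
def PosMapFeasible (L : ∀ c : κ, Matrix ι ι ℂ → Matrix (ι × ι) (ι × ι) ℂ → Matrix (X c) (X c) ℂ)
    (γ : Matrix ι ι ℂ) (Γ : Matrix (ι × ι) (ι × ι) ℂ) : Prop :=
  ∀ c, (L c γ Γ).PosSemidef

/-- CSL's example list written in the topic's maps: P `𝓛₁(Γ) = Γ`, Q `𝓛_Q` (`qMap`, Mazziotti 2007
eq. (14)), G `𝓛_G` (`gMap`, eq. (15)), all with block type `ι × ι`.
[cite: CancesStoltzLewin2006, §3 (the P, Q, G conditions after eq. (10))] -/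
def dqgMaps : ∀ _ : Fin 3, Matrix ι ι ℂ → Matrix (ι × ι) (ι × ι) ℂ → Matrix (ι × ι) (ι × ι) ℂ
  | ⟨0, _⟩ => fun _ Γ => Γ
  | ⟨1, _⟩ => fun γ Γ => qMap γ Γ
  | ⟨_ + 2, _⟩ => fun γ Γ => gMap γ Γ

omit [Fintype ι] in
/-- For the P, Q, G family, `PosMapFeasible` is the topic's triple of 2-positivity conditions
`Γ ⪰ 0 ∧ qMap γ Γ ⪰ 0 ∧ gMap γ Γ ⪰ 0` (the `d_psd`, `q_psd`, `g_psd` fields of `IsDQGFeasible`).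
[cite: CancesStoltzLewin2006, §3 (the P, Q, G conditions after eq. (10))] -/
theorem posMapFeasible_dqgMaps_iff (γ : Matrix ι ι ℂ) (Γ : Matrix (ι × ι) (ι × ι) ℂ) :
    PosMapFeasible dqgMaps γ Γ ↔
      Γ.PosSemidef ∧ (qMap γ Γ).PosSemidef ∧ (gMap γ Γ).PosSemidef := by
  constructor
  · intro hf
    exact ⟨hf ⟨0, by omega⟩, hf ⟨1, by omega⟩, hf ⟨2, by omega⟩⟩
  · rintro ⟨hD, hQ, hG⟩ ⟨c, hc⟩
    match c, hc with
    | 0, _ => exact hD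
    | 1, _ => exact hQ
    | n + 2, _ => exact hG

/-- Every DQG-feasible pair of the topic is feasible for CSL's P, Q, G family.
[cite: CancesStoltzLewin2006, §3 (the P, Q, G conditions after eq. (10))] -/
theorem IsDQGFeasible.posMapFeasible_dqgMaps {N : ℕ} {γ : Matrix ι ι ℂ}
    {Γ : Matrix (ι × ι) (ι × ι) ℂ} (hf : IsDQGFeasible N γ Γ) : PosMapFeasible dqgMaps γ Γ :=
  (posMapFeasible_dqgMaps_iff γ Γ).2 ⟨hf.d_psd, hf.q_psd, hf.g_psd⟩

/-- The P, Q, G family is a necessary condition set for every `N` (through `IsDQGFeasible.of_state`).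
[cite: CancesStoltzLewin2006, §3 eq. (7)] -/
theorem isNecessary_posMapFeasible_dqgMaps (N : ℕ) :
    IsNecessary N (PosMapFeasible (dqgMaps (ι := ι))) :=
  (isNecessary_isDQGFeasible N).mono fun _ _ hf => hf.posMapFeasible_dqgMaps

omit [LinearOrder ι] [Fintype ι] in
/-- **The pairing of the polar cone is nonnegative on the feasible cone**: for multipliers `B_c ⪰ 0`
and a feasible pair, `0 ≤ Re Σ_c tr(B_c · 𝓛_c(γ, Γ))` (the inner product of two positive
semidefinite matrices is nonnegative — the reason `Σ (𝓛_ℓ)* B_ℓ`, `B_ℓ ≥ 0`, lies in `(𝒞_app)*`,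
CSL eq. (8)). [cite: CancesStoltzLewin2006, §3 eq. (8)] -/
theorem re_sum_trace_mul_nonneg_of_posMapFeasible [∀ c, DecidableEq (X c)]
    {L : ∀ c : κ, Matrix ι ι ℂ → Matrix (ι × ι) (ι × ι) ℂ → Matrix (X c) (X c) ℂ}
    {B : ∀ c : κ, Matrix (X c) (X c) ℂ} (hB : ∀ c, (B c).PosSemidef)
    {γ : Matrix ι ι ℂ} {Γ : Matrix (ι × ι) (ι × ι) ℂ} (hf : PosMapFeasible L γ Γ) :
    0 ≤ (∑ c, (B c * L c γ Γ).trace).re := by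
  rw [Complex.re_sum]
  exact Finset.sum_nonneg fun c _ =>
    Literature.LinearAlgebra.Matrix.NearestPositiveSemidefinite.re_trace_mul_nonneg (hB c) (hf c)

/-- **Weak duality, pointwise (the dual-cone certificate).** Data: multipliers `B_c ⪰ 0` for the
positivity conditions, free multipliers `λ_r` for finitely many equality rows `A_r(γ, Γ) = b_r`, a
constant `μ`, and the Lagrangian identity
`E(γ, Γ) − μ = Σ_c tr(B_c · 𝓛_c(γ, Γ)) + Σ_r λ_r (A_r(γ, Γ) − b_r)` for ALL pairs — for linear
`𝓛_c` the statement `K_N − μ ∈ (𝒞_app)* = {Σ_ℓ (𝓛_ℓ)* B_ℓ | B_ℓ ≥ 0}` of CSL eqs. (8), (10), the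
adjoints being defined by `tr((𝓛_ℓ)*B · Γ) = tr(B · 𝓛_ℓ(Γ))`, with CSL's single row
`tr Γ = N(N−1)` generalised to a finite row list. Then at every pair that is feasible
(`𝓛_c(γ, Γ) ⪰ 0`) and satisfies the rows, `μ ≤ Re E(γ, Γ)`. [cite: CancesStoltzLewin2006, §3 eqs. (8), (10)] -/
theorem le_re_rdmEnergy_of_dualCone_certificate {Λ : Type*} [LinearOrder Λ] [Fintype Λ]
    [∀ c, DecidableEq (X c)] (h : Λ → Λ → ℂ) (g : Λ → Λ → Λ → Λ → ℂ) (hnuc : ℂ)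
    (L : ∀ c : κ, Matrix (Orb Λ) (Orb Λ) ℂ → Matrix (Orb Λ × Orb Λ) (Orb Λ × Orb Λ) ℂ →
      Matrix (X c) (X c) ℂ)
    {ρ : Type*} [Fintype ρ]
    (A : ρ → Matrix (Orb Λ) (Orb Λ) ℂ → Matrix (Orb Λ × Orb Λ) (Orb Λ × Orb Λ) ℂ → ℂ) (rhs : ρ → ℂ)
    {B : ∀ c : κ, Matrix (X c) (X c) ℂ} (hB : ∀ c, (B c).PosSemidef) (lam : ρ → ℂ) {μ : ℝ}
    (hcert : ∀ γ Γ, rdmEnergy h g hnuc γ Γ - (μ : ℂ) =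
      ∑ c, (B c * L c γ Γ).trace + ∑ r, lam r * (A r γ Γ - rhs r))
    {γ : Matrix (Orb Λ) (Orb Λ) ℂ} {Γ : Matrix (Orb Λ × Orb Λ) (Orb Λ × Orb Λ) ℂ}
    (hf : PosMapFeasible L γ Γ) (hA : ∀ r, A r γ Γ = rhs r) :
    μ ≤ (rdmEnergy h g hnuc γ Γ).re := by
  have hrows : ∑ r, lam r * (A r γ Γ - rhs r) = 0 :=
    Finset.sum_eq_zero fun r _ => by rw [hA r, sub_self, mul_zero]
  have hpos := re_sum_trace_mul_nonneg_of_posMapFeasible hB hf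
  have hid := congrArg Complex.re (hcert γ Γ)
  rw [hrows, add_zero, Complex.sub_re, Complex.ofReal_re] at hid
  linarith

/-- **DUAL-CONE CERTIFICATE ⇒ SECTOR GROUND-ENERGY LOWER BOUND** (generic SDP weak-duality
soundness for an arbitrary finite condition set). For Hermitian integral data, a non-trivial sector
`a, b ≤ |Λ|`, a finite family of positivity conditions `𝓛_c` and equality rows `A_r = b_r` that are
NECESSARY in the sector `(a, b)`, positive semidefinite multipliers `B_c`, free multipliers `λ_r` and
a constant `μ` satisfying the Lagrangian identity of `le_re_rdmEnergy_of_dualCone_certificate`: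
`μ ≤ E₀(Ĥ; N_α = a, N_β = b)`. This is `N(N−1) sup{μ | K_N − μ ∈ (𝒞_app)*} = E_app ≤ E` of
Cancès–Stoltz–Lewin eqs. (8)–(10) read for ONE dual-feasible point (weak duality), in the sector
form of Mazziotti 2007 §II.F; one-line composition of the pointwise lemma with
`le_sectorGroundEnergy_of_forall_necessary`. [cite: CancesStoltzLewin2006, §3 eqs. (8)-(10)] -/
theorem le_sectorGroundEnergy_of_dualCone_certificate {Λ : Type*} [LinearOrder Λ] [Fintype Λ]
    [∀ c, DecidableEq (X c)] {h : Λ → Λ → ℂ} {g : Λ → Λ → Λ → Λ → ℂ} {hnuc : ℂ}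
    (hH : (molecularHamiltonian h g hnuc).IsHermitian) {a b : ℕ} (ha : a ≤ Fintype.card Λ)
    (hb : b ≤ Fintype.card Λ)
    (L : ∀ c : κ, Matrix (Orb Λ) (Orb Λ) ℂ → Matrix (Orb Λ × Orb Λ) (Orb Λ × Orb Λ) ℂ →
      Matrix (X c) (X c) ℂ)
    (hL : IsNecessaryInSector a b (PosMapFeasible L)) {ρ : Type*} [Fintype ρ]
    (A : ρ → Matrix (Orb Λ) (Orb Λ) ℂ → Matrix (Orb Λ × Orb Λ) (Orb Λ × Orb Λ) ℂ → ℂ) (rhs : ρ → ℂ)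
    (hArows : IsNecessaryInSector a b fun γ Γ => ∀ r, A r γ Γ = rhs r)
    {B : ∀ c : κ, Matrix (X c) (X c) ℂ} (hB : ∀ c, (B c).PosSemidef) (lam : ρ → ℂ) {μ : ℝ}
    (hcert : ∀ γ Γ, rdmEnergy h g hnuc γ Γ - (μ : ℂ) =
      ∑ c, (B c * L c γ Γ).trace + ∑ r, lam r * (A r γ Γ - rhs r)) :
    μ ≤ sectorGroundEnergy (molecularHamiltonian h g hnuc) a b :=
  le_sectorGroundEnergy_of_forall_necessary hH ha hb (hL.and hArows)
    fun _ _ hf => le_re_rdmEnergy_of_dualCone_certificate h g hnuc L A rhs hB lam hcert hf.1 hf.2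

/-- **DUAL-CONE CERTIFICATE ⇒ `N`-ELECTRON GROUND-ENERGY LOWER BOUND** (CSL's own setting, no spin
constraint): with conditions and rows necessary for `N` electrons (`N ≤ 2|Λ|`), the same certificate
gives `μ ≤ E₀(Ĥ; N)`. Cancès–Stoltz–Lewin (2006) §3 eqs. (8)–(10) (`E_app ≤ E`), one dual-feasible
point. [cite: CancesStoltzLewin2006, §3 eqs. (8)-(10)] -/
theorem le_groundEnergy_of_dualCone_certificate {Λ : Type*} [LinearOrder Λ] [Fintype Λ]
    [∀ c, DecidableEq (X c)] (h : Λ → Λ → ℂ) (g : Λ → Λ → Λ → Λ → ℂ) (hnuc : ℂ)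
    {N : ℕ} (hN : N ≤ Fintype.card (Orb Λ))
    (L : ∀ c : κ, Matrix (Orb Λ) (Orb Λ) ℂ → Matrix (Orb Λ × Orb Λ) (Orb Λ × Orb Λ) ℂ →
      Matrix (X c) (X c) ℂ)
    (hL : IsNecessary N (PosMapFeasible L)) {ρ : Type*} [Fintype ρ]
    (A : ρ → Matrix (Orb Λ) (Orb Λ) ℂ → Matrix (Orb Λ × Orb Λ) (Orb Λ × Orb Λ) ℂ → ℂ) (rhs : ρ → ℂ)
    (hArows : IsNecessary N fun γ Γ => ∀ r, A r γ Γ = rhs r)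
    {B : ∀ c : κ, Matrix (X c) (X c) ℂ} (hB : ∀ c, (B c).PosSemidef) (lam : ρ → ℂ) {μ : ℝ}
    (hcert : ∀ γ Γ, rdmEnergy h g hnuc γ Γ - (μ : ℂ) =
      ∑ c, (B c * L c γ Γ).trace + ∑ r, lam r * (A r γ Γ - rhs r)) :
    μ ≤ Literature.MathematicalPhysics.QuantumLattice.groundEnergy (molecularHamiltonian h g hnuc) N :=
  le_groundEnergy_of_forall_necessary h g hnuc hN (hL.and hArows)
    fun _ _ hf => le_re_rdmEnergy_of_dualCone_certificate h g hnuc L A rhs hB lam hcert hf.1 hf.2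

end DualCone

end Literature.MathematicalPhysics.QuantumChemistry

end
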